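import Summits.Ventures.HSemireg.UntwistComplexSigmaTwist
import Summits.Ventures.HSemireg.HomComplexSigmaSingle
import Summits.Ventures.HSemireg.HomComplexSigmaConj
import Literature.AlgebraicGeometry.KTheory.EulerCharacteristic
import HarnessLib

/-!
# Venture HSemireg — route R1.0, untwisted reading: `I`-semiregularity of a vector bundle `E₀` iff of `E₀ ⊗ M`, with NO
# hypothesis on the `Ωʲ_{X/S}` (gs-g4; corollary of the complex-carrier theorem `HomComplex.isISemiregularC_iff_twist`)

HONEST FRAMING. Venture-lane plumbing on the tree's real carriers; nothing about any variety; no gerbe; nothing here says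
HC, HC_CM or HC_AV is proved. This file only COMBINES landed results:

* the complex-carrier end theorem `HomComplex.isISemiregularC_iff_twist` (`UntwistComplexSigmaTwist.lean`: for `X` an
  `S`-scheme, `K` strictly in `[a, b]` with finite locally free terms, `c` ANY unit `1`-cocycle, EVERY lower set `I`:
  `IsISemiregularC X K a b _ I ↔ IsISemiregularC X (K ⊗ M) a b _ I` — no smoothness / coframe hypothesis);
* t-7's isomorphism invariance `HomComplex.isISemiregularC_iff_of_iso` (`HomComplexSigmaConj.lean`);
* the single-sheaf anchor `HomComplex.isISemiregularC_single₀_iff` (`HomComplexSigmaSingle.lean`: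
  `IsISemiregularC(E₀[0], I) ↔ IsISemiregular(E₀, I)`);
* Mathlib's `HomologicalComplex.singleMapHomologicalComplex` (`(E₀[0]) ⊗ M ≅ (E₀ ⊗ M)[0]` termwise).

RESULTS (namespace `Summit.Ventures.HSemireg.CocycleTwist`):
1. `cocycleTwistComplexSingle₀Iso` — the isomorphism of cochain complexes `(E₀[0]) ⊗ M ≅ (E₀ ⊗ M)[0]`.
2. **`isISemiregular_iff_twist_general`** — the SHEAF-level statement `IsISemiregular(E₀, I) ↔ IsISemiregular(E₀ ⊗ M, I)`
   for every lower set `I`, every cocycle `c`, every finite locally free `E₀` on ANY `S`-scheme `X` — gen 20's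
   `isISemiregular_iff_twist_of_locallyFree` (`UntwistCocycleTwistSigmaAll.lean`) WITHOUT `hΩ` (there `hΩ` was discharged
   only for `X/S` smooth or `Ω¹_{X/S}` free; here it is not needed: the complex-carrier Leibniz re-expansion of
   `UntwistComplexSigmaTwist.lean` uses no coframes). Proof: `HomComplex.isISemiregularC_iff_twist` at `K = E₀[0]`,
   transported along (1) by `isISemiregularC_iff_of_iso`, read through the anchor `isISemiregularC_single₀_iff` on both sides
   (the window-`[0,0]` complex statement without `hΩ` is that one-line composite; with `hΩ` it is gen 20's
   `isISemiregularC_single₀_iff_twist_of_locallyFree`). `I = univ`: `isISemiregular_univ_iff_twist_general`.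
3. `isISemiregularC_twist_iff_twist` / `isISemiregular_twist_iff_twist` — for ANY two cocycles `c`, `c'` (cohomologous or
   not): `K ⊗ M_c` is `I`-semiregular iff `K ⊗ M_{c'}` is (both iff `K`); th-4's class-level statements
   (`UntwistCocycleTwistClassSigma.lean`, cohomologous `c ~ c'`) are the special case.

## References

* R.-O. Buchweitz, H. Flenner, *A semiregularity map for modules and applications to deformations*, Compositio Math. 137
  (2003), Def. 4.1, §5 (`I`-semiregular). [BuchweitzFlenner2003]
* M. F. Atiyah, *Complex analytic connections in fibre bundles*, Trans. AMS 85 (1957), Prop. 10, Prop. 12 (Leibniz rule for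
  the Atiyah class of a tensor product — the content of the re-expansion, proved on complex carriers upstream). [Atiyah1957]
-/

noncomputable section

set_option backward.isDefEq.respectTransparency false

open CategoryTheory CategoryTheory.Limits AlgebraicGeometry

namespace Summit.Ventures.HSemireg

namespace CocycleTwist

open Literature.AlgebraicGeometry.Modules Literature.AlgebraicGeometry.Motives Literature.AlgebraicGeometry.HodgeTheory
  Literature.AlgebraicGeometry.KTheory HomComplex

universe w u

variable {S : Type u} [CommRing S] (X : Over (Spec (CommRingCat.of S))) (c c' : UnitCocycle X.left)

/-! ### 1. `(E₀[0]) ⊗ M ≅ (E₀ ⊗ M)[0]` -/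

/-- **The termwise twist of a single complex is the single complex of the twist**: `(E₀[0]) ⊗ M ≅ (E₀ ⊗ M)[0]`
(Mathlib's `singleMapHomologicalComplex` for the additive functor `- ⊗ M = (twistEquivalence X c).functor`). [folklore] -/
def cocycleTwistComplexSingle₀Iso (E₀ : X.left.Modules) :
    cocycleTwistComplex c (single₀ X.left E₀) ≅ single₀ X.left (twist c E₀) :=
  (HomologicalComplex.singleMapHomologicalComplex (twistEquivalence X.left c).functor (ComplexShape.up ℤ) 0).app E₀

/-- The terms of a single complex of a finite locally free module are finite locally free. [folklore] -/
theorem isFiniteLocallyFree_single₀_X {E₀ : X.left.Modules} (hE₀ : IsFiniteLocallyFree E₀) (p : ℤ) :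
    IsFiniteLocallyFree ((single₀ X.left E₀).X p) :=
  (IsBoundedVBComplex.single E₀ hE₀ 0).isFiniteLocallyFree p

/-! ### 2. Complex carriers, window `[0, 0]` -/

section Complex

variable [HasDerivedCategory.{w} X.left.Modules]

/-- **For ANY two cocycles `c`, `c'`: `K ⊗ M_c` is `I`-semiregular iff `K ⊗ M_{c'}` is** (`K` strictly in `[a, b]` with
finite locally free terms, `I` a lower set) — both sides are equivalent to `I`-semiregularity of `K` itself
(`HomComplex.isISemiregularC_iff_twist`). [cite: BuchweitzFlenner2003, §5 (I-semiregular)] -/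
theorem isISemiregularC_twist_iff_twist (K : CochainComplex X.left.Modules ℤ) (a b : ℤ) [K.IsStrictlyGE a]
    [K.IsStrictlyLE b] (hK : ∀ p, IsFiniteLocallyFree (K.X p)) {I : Set ℕ} (hI : IsLowerSet I) :
    IsISemiregularC X (cocycleTwistComplex c K) a b (isFiniteLocallyFree_cocycleTwistComplex_X c hK) I ↔
      IsISemiregularC X (cocycleTwistComplex c' K) a b (isFiniteLocallyFree_cocycleTwistComplex_X c' hK) I :=
  (isISemiregularC_iff_twist X K c a b hK hI).symm.trans (isISemiregularC_iff_twist X K c' a b hK hI)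

end Complex

/-! ### 3. Sheaf carriers: the module-level `IsISemiregular`, no `hΩ` -/

section Sheaf

variable {X} [HasExt.{u + 1} X.left.Modules] {E₀ : X.left.Modules} (hE₀ : IsFiniteLocallyFree E₀)

/-- **`I`-semiregularity of `E₀` iff of `E₀ ⊗ M` — every lower set `I`, every cocycle `c`, every finite locally free `E₀`,
ANY `S`-scheme `X`** (no hypothesis on the `Ωʲ_{X/S}`): gen 20's `isISemiregular_iff_twist_of_locallyFree` without `hΩ`.
Proof: `HomComplex.isISemiregularC_iff_twist` at `K = E₀[0]`, transported along `(E₀[0]) ⊗ M ≅ (E₀ ⊗ M)[0]`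
(`isISemiregularC_iff_of_iso`), read through the single-sheaf anchor `isISemiregularC_single₀_iff` on both sides, in the
standard derived category of `Mod(𝒪_X)` (`HasExt` is a proposition, so the choice is immaterial).
[cite: BuchweitzFlenner2003, §5 (I-semiregular); Atiyah1957, Prop. 10 and Prop. 12] -/
theorem isISemiregular_iff_twist_general {I : Set ℕ} (hI : IsLowerSet I) :
    IsISemiregular.{u + 1} hE₀ I ↔ IsISemiregular.{u + 1} (isFiniteLocallyFree_twist c hE₀) I := by
  letI := HasDerivedCategory.standard X.left.Modules
  have hK := isFiniteLocallyFree_single₀_X X hE₀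
  have hK' := isFiniteLocallyFree_single₀_X X (isFiniteLocallyFree_twist c hE₀)
  rw [← isISemiregularC_single₀_iff X E₀ hE₀ hK, ← isISemiregularC_single₀_iff X (twist c E₀) (isFiniteLocallyFree_twist c hE₀) hK']
  exact (isISemiregularC_iff_twist X (single₀ X.left E₀) c 0 0 hK hI).trans
    (isISemiregularC_iff_of_iso X 0 0 (isFiniteLocallyFree_cocycleTwistComplex_X c hK) hK'
      (cocycleTwistComplexSingle₀Iso X c E₀) I)

/-- **FULL semiregularity of `E₀` iff of `E₀ ⊗ M`** (`I = univ`), no hypothesis on the `Ωʲ_{X/S}`.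
[cite: BuchweitzFlenner2003, Def. 4.1 and §5] -/
theorem isISemiregular_univ_iff_twist_general :
    IsISemiregular.{u + 1} hE₀ Set.univ ↔ IsISemiregular.{u + 1} (isFiniteLocallyFree_twist c hE₀) Set.univ :=
  isISemiregular_iff_twist_general c hE₀ isLowerSet_univ

/-- **For ANY two cocycles `c`, `c'`: `E₀ ⊗ M_c` is `I`-semiregular iff `E₀ ⊗ M_{c'}` is** (`I` a lower set; both iff
`E₀`). [cite: BuchweitzFlenner2003, §5 (I-semiregular)] -/
theorem isISemiregular_twist_iff_twist {I : Set ℕ} (hI : IsLowerSet I) :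
    IsISemiregular.{u + 1} (isFiniteLocallyFree_twist c hE₀) I ↔
      IsISemiregular.{u + 1} (isFiniteLocallyFree_twist c' hE₀) I :=
  (isISemiregular_iff_twist_general c hE₀ hI).symm.trans (isISemiregular_iff_twist_general c' hE₀ hI)

end Sheaf

end CocycleTwist

end Summit.Ventures.HSemireg

end
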